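import Literature.NumberTheory.EllipticCurves.EisensteinNewformLevelRaisingInertiaProofs
import Literature.NumberTheory.EllipticCurves.NewformGaloisRepInertiaInvariants
import HarnessLib

/-!
# Hida 2000, Thm. 3.26 (3)(a): the named fact from Carayol 1986, Thm. (A) BY NAME

Topic `Literature/NumberTheory/EllipticCurves`; namespace `Literature.NumberTheory.EllipticCurves`.
Proofs only (no definition, no named fact; D-0026).  Sibling of the fact file
`EisensteinNewformLevelRaising.lean` (the named fact `Hida2000_thm326_inertia_of_level`: for a
newform `g ∈ S_k(Γ₁(N))`, `k ≥ 2`, with nebentypus `χ`, `ρ = ρ_{g,ι}` irreducible over `ℚ̄_p`, and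
a prime `ℓ ≠ p`, `ℓ ∣ N` with `v_ℓ(N) = v_ℓ(cond χ)`, the inertia group `I_𝔔`, `𝔔 ∣ ℓ`, acts in
some frame through `diag(χ, 1)` — H. Hida, *Modular Forms and Galois Cohomology* (2000),
Thm. 3.26 (3)(a), p. 152; the book takes the theorem for granted, p. 153, referring to Langlands
1973 and Carayol 1986) and of its proofs-only companions `…InertiaProofs` (Parts A–G),
`…InertiaLocalGlobalProofs` (H), `…InertiaLFactorProofs` (I), `…InertiaNewvectorProofs` (L),
`…InertiaAdelicUellProofs` (B), `…InertiaLocalComponentProofs` (C) and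
`…InertiaLocalGlobalTwistProofs` (D).

Two roads to the named fact are theorems of the tree, each from ONE existing named fact:

* from the Carayol–Taylor–Skinner carrier in Weil–Deligne form,
  `Automorphic.galoisRep_GL2_totallyReal_localGlobal`:
  `Hida2000Thm326.inertia_of_level_of_localGlobal'` (`…InertiaLocalGlobalTwistProofs`);
* from Carayol 1986, Thm. (A) read on the degree of the `ℓ`-Euler factor,
  `Carayol1986_finrank_inertiaInvariants` (`NewformGaloisRepInertiaInvariants.lean`, whose body is
  VERBATIM the hypothesis `H` of `Hida2000Thm326.inertia_of_level_of_finrank_inertiaInvariants`,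
  `…InertiaProofs`, Part G): this file, which records that reduction BY NAME, so that the
  dependency `Carayol1986_finrank_inertiaInvariants → Hida2000_thm326_inertia_of_level` is an edge
  of the tree —

  `Hida2000_thm326_inertia_of_level_of_carayol1986 :
     Carayol1986_finrank_inertiaInvariants → Hida2000_thm326_inertia_of_level`.

The argument (Part G): at a prime `ℓ ∣ N` with `v_ℓ(N) = v_ℓ(cond χ)` one has `a_ℓ(g) ≠ 0`
(Li 1975, Thm. 3 (ii); `Hida2000Thm326.coeff_ne_zero_of_padicValNat_eq`), so by Carayol's theorem
the inertia invariants `(ℚ̄_p²)^{ρ(I_𝔔)}` form a line, in particular are non-zero, and a non-zero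
inertia-fixed vector together with `det ρ = ι⁻¹χ(χ_N)·χ_p^{k-1}` (trivial cyclotomic factor on
`I_𝔔`, `ℓ ≠ p`) puts `ρ|_{I_𝔔}` in the shape `diag(χ, 1)`
(`Hida2000Thm326.inertia_shape_of_fixedSubmodule_inertia_ne_bot`).

Consequently the discharge of the fact is the one-liner
`theorem Hida2000_thm326_inertia_of_level_holds : Hida2000_thm326_inertia_of_level :=
Hida2000_thm326_inertia_of_level_of_carayol1986 Carayol1986_finrank_inertiaInvariants_holds`
as soon as `Carayol1986_finrank_inertiaInvariants_holds` exists (it belongs in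
`NewformGaloisRepInertiaInvariants.lean` or a sibling; the fact file
`EisensteinNewformLevelRaising.lean` must not import this file) — or, by the first road,
`Hida2000Thm326.inertia_of_level_of_localGlobal' galoisRep_GL2_totallyReal_localGlobal_holds`.

## References

* H. Hida, *Modular Forms and Galois Cohomology*, Cambridge Stud. Adv. Math. 69 (2000),
  Thm. 3.26 (3)(a), pp. 152–153. [Hida2000]
* H. Carayol, *Sur les représentations ℓ-adiques associées aux formes modulaires de Hilbert*,
  Ann. Sci. ÉNS (4) 19 (1986) 409–468, Thm. (A), (0.5), (0.7), (0.8) (pp. 410–411).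
  [CarayolASENS1986]
* R. P. Langlands, *Modular forms and ℓ-adic representations*, in: Modular Functions of One
  Variable II, Lecture Notes in Math. 349 (1973) 361–500, Thm. 7.1. [Langlands1973]
* W.-C. W. Li, *Newforms and functional equations*, Math. Ann. 212 (1975) 285–315, Thm. 3.
  [Li1975]
-/

noncomputable section

namespace Literature.NumberTheory.EllipticCurves

/-- **Hida 2000, Thm. 3.26 (3)(a), from Carayol 1986, Thm. (A) by name.**  The named fact
`Hida2000_thm326_inertia_of_level` (inertia at a prime `ℓ ∣ N`, `ℓ ≠ p`, with
`v_ℓ(N) = v_ℓ(cond χ)` acts through `diag(χ, 1)` on the irreducible `p`-adic representation of a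
newform of weight `k ≥ 2`) follows from the named fact `Carayol1986_finrank_inertiaInvariants`
(`dim (ℚ̄_p²)^{ρ(I_𝔔)} = deg (1 - a_ℓ T)` at every `ℓ ∣ N`, `ℓ ≠ p`), whose body is verbatim the
hypothesis `H` of the accepted reduction
`Hida2000Thm326.inertia_of_level_of_finrank_inertiaInvariants` (Part G: `a_ℓ(g) ≠ 0` when
`v_ℓ(N) = v_ℓ(cond χ)`, so the inertia invariants are a line, hence non-zero, and
`Hida2000Thm326.inertia_shape_of_fixedSubmodule_inertia_ne_bot` applies).
[cite: Hida2000, Thm. 3.26 (3)(a), pp. 152–153]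
[cite: CarayolASENS1986, Thm. (A) (0.7) with (0.5), (0.8), pp. 410–411]
[cite: Langlands1973, Thm. 7.1] -/
theorem Hida2000_thm326_inertia_of_level_of_carayol1986
    (h : Carayol1986_finrank_inertiaInvariants) : Hida2000_thm326_inertia_of_level :=
  Hida2000Thm326.inertia_of_level_of_finrank_inertiaInvariants h

end Literature.NumberTheory.EllipticCurves

end
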